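import Summits.BirchSwinnertonDyer.Rank1Residual.ManinAdditive.KummerCubeMonodromy
import Summits.BirchSwinnertonDyer.BirchSwinnertonDyer.Theorems.ManinLocalTwoThreeTameThreeNeronScalarExists
import Literature.NumberTheory.EllipticCurves.WeierstrassSigmaProofs
import Literature.NumberTheory.EllipticCurves.WeierstrassZetaLegendre
import Literature.NumberTheory.EllipticCurves.RealLatticePeriodHalfPeriodsProofs
import HarnessLib

/-!
# Three leaves of the `σ`-monodromy line CLOSED: S3′ `TangentLineScaling`, S3b `SigmaCubeRootNotPeriodic`, S6 `ShortThreeTorsionLift`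
# (route `ManinLocalTwoThree`, crux C3 `ManinPrimeToThreeAtNine` stmt-BirchSwinnertonDyer-22968; cell bsd-f2-manin, p2 gen 16)

The statement file `Rank1Residual/ManinAdditive/KummerCubeMonodromy.lean` (an g37, MEMO-an §80; landed p718910) reduces the
C3 v19 leaf P79 `KummerCubeSeriesNotCubeAtThreeN` (and G0) to seven typed leaves S1, S2, S3, S3b, S4, S6, S3′
(assembly `Theorems/ManinLocalTwoThreeKummerCubeMonodromy.lean`).  This file PROVES three of them, by name:

* `tangentLineScaling : TangentLineScaling` (S3′) — with `X₀ = c²℘(a)`, `Y₀ = c³℘'(a)/2`, `g₂(Λ) = c₄(W)/12`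
  (`isNeronLattice`) the short-model tangent slope is `c·α_a` (`tangentSlope_cast_eq`, also for `c = 0` where both
  sides vanish) and `Θ^an_T = c³·t_s³·ℓ_a(w)`.
* `sigmaCubeRootNotPeriodic : SigmaCubeRootNotPeriodic` (S3b) — quasi-periodicity of `σ`
  (`weierstrassSigma_add_ω₁/ω₂_holds`) gives `W_{a,e}(−a + ωᵢ) = exp(eωᵢ/3 − ηᵢa)·W_{a,e}(−a)`, `W(−a) ≠ 0` as
  `a, 2a ∉ Λ`; for `e = m₁η₁ + m₂η₂`, `3a = m₁ω₁ + m₂ω₂` the exponents are `m₂(η₂ω₁ − η₁ω₂)/3`, `m₁(η₁ω₂ − η₂ω₁)/3`, and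
  Legendre (`legendre_relation_holds` / `_of_neg`, `im_ω₂_div_ω₁_pos_or`) makes one of them `±2πi·m/3` with `3 ∤ m`
  (else `a ∈ Λ`), whose exponential is `≠ 1` (`Complex.exp_eq_one_iff`).
* `shortThreeTorsionLift : ShortThreeTorsionLift` (S6) — `c ≠ 0` (at `c = 0` the short model is `y² = x³`, no nonsingular
  `Ψ₃`-root point); `Ψ₃^{E_{W,c}}(X₀) = c⁸·Ψ₃^W(X₀/c² − b₂/12)`, so a third-period `z₀` with `℘(z₀) = X₀/c²` exists (the tree's
  `exists_third_period_of_Ψ₃_root`); `Y₀² = X₀³ + a₄X₀ + a₆ = (c³℘'(z₀)/2)²` (`derivWeierstrassP_sq`, `g₂ = c₄/12`,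
  `g₃ = c₆/216`) fixes the sign up to `z₀ ↦ −z₀`; `℘'(z₀) = 0` would give `2z₀ ∈ Λ`
  (`two_mul_mem_lattice_of_derivWeierstrassP_eq_zero`), hence `z₀ ∈ Λ`.
So the open leaves of the line are exactly S1 (analytic dictionary), S2 (`q`-expansion principle), S3 (`ℓ_a = C·W³`),
S4 (monodromy).  HONEST FRAMING: routine leaves of a CONDITIONAL reduction; P79, G0, E-an-57 and C3 remain OPEN; nothing
about BSD or Manin's conjecture is proved.  [cite: WhittakerWatson1927, §20.421 (σ quasi-periodicity), §20.411 (Legendre)]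
[cite: SilvermanAEC2009, VI.3.6, VI.5.1, Exercise 3.7 (Ψ₃), III.8 (Weil pairing via σ; shape)]
-/

set_option autoImplicit false
-- lint-debt: the directory name repeats the summit name (sibling precedent `ManinLocalTwoThreeCubeRootDescent.lean`)
set_option linter.dupNamespace false

noncomputable section

open Complex
open scoped PeriodPair UpperHalfPlane
open WeierstrassCurve Literature.NumberTheory.EllipticCurves Literature.NumberTheory.EllipticCurves.ModularForms
open Summit.BirchSwinnertonDyer.Rank1Residual.ManinAdditive.CuspidalKummer
open Summit.BirchSwinnertonDyer.Rank1Residual.ManinAdditive.CuspidalKummerThree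

namespace Summit.BirchSwinnertonDyer.BirchSwinnertonDyer.Theorems.ManinLocalTwoThree.KummerCubeSigmaLeaves

open Summit.BirchSwinnertonDyer.Rank1Residual.ManinAdditive.KummerCubeMonodromy

/-- The short-model tangent slope at `T = P_s(a)` is `c·α_a`: `α = (3X₀² + a₄(E_s))/(2Y₀)` with `X₀ = c²℘(a)`,
`Y₀ = c³℘'(a)/2`, `a₄(E_s) = −c⁴c₄/48 = −c⁴g₂/4` (`g₂ = c₄/12`, `isNeronLattice`). [folklore] -/
theorem tangentSlope_cast_eq {W : WeierstrassCurve ℚ} [W.IsElliptic] {N : ℕ} [NeZero N]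
    (D : ModularParametrizationData W N) (X₀ Y₀ : ℚ) (a : ℂ)
    (hX : (D.c : ℂ) ^ 2 * ℘[D.L] a = (X₀ : ℂ)) (hY : (D.c : ℂ) ^ 3 * ℘'[D.L] a / 2 = (Y₀ : ℂ)) (h℘ : ℘'[D.L] a ≠ 0) :
    ((tangentSlope W D.c X₀ Y₀ : ℚ) : ℂ) = (D.c : ℂ) * ((3 * ℘[D.L] a ^ 2 - D.L.g₂ / 4) / ℘'[D.L] a) := by
  have hg₂ : D.L.g₂ = (W.c₄ : ℂ) / 12 := by
    have h := D.isNeronLattice.1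
    rw [WeierstrassCurve.baseChange, map_c₄] at h
    simpa using h
  rw [tangentSlope, shortModel]
  push_cast
  rw [← hX, ← hY, hg₂]
  by_cases hc : (D.c : ℂ) = 0
  · rw [hc]; simp
  · field_simp
    ring

/-- **S3′ `TangentLineScaling` PROVED** (routine algebra): `Θ^an_T(τ) = c³·t_s(τ)³·ℓ_a(w(τ))` for `T = P_s(a)`. [folklore] -/
theorem tangentLineScaling : TangentLineScaling := by
  intro W _ _ N _ D X₀ Y₀ a hX hY h℘ τ
  rw [kummerCubeFunction, tangentSlope_cast_eq D X₀ Y₀ a hX hY h℘, tangentLinePullback, ← hX, ← hY, shortX, shortY]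
  field_simp

/-! ### S3b — the `σ`-cube root is not `Λ`-periodic -/

/-- Quasi-periodicity of the `σ`-cube root at the point `w = −a`:
`W_{a,e}(−a + ω₁) = exp(e ω₁/3 − η₁ a) · W_{a,e}(−a)` (from `σ(z + ω₁) = −e^{η₁(z + ω₁/2)} σ(z)`).
[cite: WhittakerWatson1927, §20.421] -/
theorem sigmaCubeRoot_neg_add_ω₁ (L : PeriodPair) (a e : ℂ) (ha : a ∉ L.lattice) :
    sigmaCubeRoot L a e (-a + L.ω₁) = cexp (e * L.ω₁ / 3 - L.η₁ * a) * sigmaCubeRoot L a e (-a) := by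
  have hσ1 := L.weierstrassSigma_add_ω₁_holds
  have hσa : L.weierstrassSigma (-a) ≠ 0 := fun h ↦ ha (by
    have := (L.weierstrassSigma_eq_zero_iff_holds (-a)).mp h
    simpa using L.lattice.neg_mem this)
  have key : cexp (e * (-a + L.ω₁) / 3) * cexp (L.η₁ * (-a - a + L.ω₁ / 2)) =
      cexp (e * L.ω₁ / 3 - L.η₁ * a) * cexp (e * (-a) / 3) * cexp (L.η₁ * (-a + L.ω₁ / 2)) := by
    rw [← Complex.exp_add, ← Complex.exp_add, ← Complex.exp_add]
    congr 1
    ring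
  have hE : cexp (L.η₁ * (-a + L.ω₁ / 2)) ≠ 0 := Complex.exp_ne_zero _
  unfold sigmaCubeRoot
  rw [show -a + L.ω₁ - a = (-a - a) + L.ω₁ by ring, hσ1 (-a - a), hσ1 (-a)]
  calc cexp (e * (-a + L.ω₁) / 3) * (-cexp (L.η₁ * (-a - a + L.ω₁ / 2)) * L.weierstrassSigma (-a - a)) /
        (-cexp (L.η₁ * (-a + L.ω₁ / 2)) * L.weierstrassSigma (-a))
      = (cexp (e * (-a + L.ω₁) / 3) * cexp (L.η₁ * (-a - a + L.ω₁ / 2))) * L.weierstrassSigma (-a - a) /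
        (cexp (L.η₁ * (-a + L.ω₁ / 2)) * L.weierstrassSigma (-a)) := by ring
    _ = (cexp (e * L.ω₁ / 3 - L.η₁ * a) * cexp (e * (-a) / 3) * cexp (L.η₁ * (-a + L.ω₁ / 2))) *
        L.weierstrassSigma (-a - a) / (cexp (L.η₁ * (-a + L.ω₁ / 2)) * L.weierstrassSigma (-a)) := by rw [key]
    _ = cexp (e * L.ω₁ / 3 - L.η₁ * a) * (cexp (e * (-a) / 3) * L.weierstrassSigma (-a - a) / L.weierstrassSigma (-a)) := by
          field_simp

/-- The same at `ω₂`: `W_{a,e}(−a + ω₂) = exp(e ω₂/3 − η₂ a) · W_{a,e}(−a)`. [cite: WhittakerWatson1927, §20.421] -/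
theorem sigmaCubeRoot_neg_add_ω₂ (L : PeriodPair) (a e : ℂ) (ha : a ∉ L.lattice) :
    sigmaCubeRoot L a e (-a + L.ω₂) = cexp (e * L.ω₂ / 3 - L.η₂ * a) * sigmaCubeRoot L a e (-a) := by
  have hσ2 := L.weierstrassSigma_add_ω₂_holds
  have hσa : L.weierstrassSigma (-a) ≠ 0 := fun h ↦ ha (by
    have := (L.weierstrassSigma_eq_zero_iff_holds (-a)).mp h
    simpa using L.lattice.neg_mem this)
  have key : cexp (e * (-a + L.ω₂) / 3) * cexp (L.η₂ * (-a - a + L.ω₂ / 2)) =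
      cexp (e * L.ω₂ / 3 - L.η₂ * a) * cexp (e * (-a) / 3) * cexp (L.η₂ * (-a + L.ω₂ / 2)) := by
    rw [← Complex.exp_add, ← Complex.exp_add, ← Complex.exp_add]
    congr 1
    ring
  have hE : cexp (L.η₂ * (-a + L.ω₂ / 2)) ≠ 0 := Complex.exp_ne_zero _
  unfold sigmaCubeRoot
  rw [show -a + L.ω₂ - a = (-a - a) + L.ω₂ by ring, hσ2 (-a - a), hσ2 (-a)]
  calc cexp (e * (-a + L.ω₂) / 3) * (-cexp (L.η₂ * (-a - a + L.ω₂ / 2)) * L.weierstrassSigma (-a - a)) /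
        (-cexp (L.η₂ * (-a + L.ω₂ / 2)) * L.weierstrassSigma (-a))
      = (cexp (e * (-a + L.ω₂) / 3) * cexp (L.η₂ * (-a - a + L.ω₂ / 2))) * L.weierstrassSigma (-a - a) /
        (cexp (L.η₂ * (-a + L.ω₂ / 2)) * L.weierstrassSigma (-a)) := by ring
    _ = (cexp (e * L.ω₂ / 3 - L.η₂ * a) * cexp (e * (-a) / 3) * cexp (L.η₂ * (-a + L.ω₂ / 2))) *
        L.weierstrassSigma (-a - a) / (cexp (L.η₂ * (-a + L.ω₂ / 2)) * L.weierstrassSigma (-a)) := by rw [key]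
    _ = cexp (e * L.ω₂ / 3 - L.η₂ * a) * (cexp (e * (-a) / 3) * L.weierstrassSigma (-a - a) / L.weierstrassSigma (-a)) := by
          field_simp

/-- The `σ`-cube root does not vanish at `w = −a` when `a, 2a ∉ Λ`. [cite: WhittakerWatson1927, §20.42] -/
theorem sigmaCubeRoot_neg_ne_zero (L : PeriodPair) (a e : ℂ) (ha : a ∉ L.lattice) (h2a : 2 * a ∉ L.lattice) :
    sigmaCubeRoot L a e (-a) ≠ 0 := by
  have hσa : L.weierstrassSigma (-a) ≠ 0 := fun h ↦ ha (by
    have := (L.weierstrassSigma_eq_zero_iff_holds (-a)).mp h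
    simpa using L.lattice.neg_mem this)
  have hσ2a : L.weierstrassSigma (-a - a) ≠ 0 := fun h ↦ h2a (by
    have := (L.weierstrassSigma_eq_zero_iff_holds (-a - a)).mp h
    have h' := L.lattice.neg_mem this
    simpa [two_mul] using h')
  unfold sigmaCubeRoot
  exact div_ne_zero (mul_ne_zero (Complex.exp_ne_zero _) hσ2a) hσa

/-- `exp(s · 2πi · m / 3) = 1` with `s = ±1` forces `3 ∣ m`. [folklore] -/
theorem three_dvd_of_cexp_eq_one {s m : ℤ} (hs : s = 1 ∨ s = -1)
    (h : cexp ((m : ℂ) * ((s : ℂ) * (2 * Real.pi * I)) / 3) = 1) : (3 : ℤ) ∣ m := by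
  obtain ⟨n, hn⟩ := Complex.exp_eq_one_iff.mp h
  have h2πI : (2 * Real.pi * I : ℂ) ≠ 0 := by
    simp [Real.pi_ne_zero, Complex.I_ne_zero]
  have hms : ((m * s : ℤ) : ℂ) = ((3 * n : ℤ) : ℂ) := by
    field_simp at hn
    push_cast
    linear_combination hn
  have hz : m * s = 3 * n := by exact_mod_cast hms
  rcases hs with rfl | rfl
  · exact ⟨n, by linarith⟩
  · exact ⟨-n, by linarith⟩

/-- **S3b `SigmaCubeRootNotPeriodic` PROVED.**  For `a ∉ Λ` with `3a = m₁ω₁ + m₂ω₂`, the `σ`-cube root `W = W_{a,η(3a)}`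
satisfies `W(−a + ω₁) = exp(m₂(η₂ω₁ − η₁ω₂)/3)·W(−a)`, `W(−a + ω₂) = exp(m₁(η₁ω₂ − η₂ω₁)/3)·W(−a)` with `W(−a) ≠ 0`
(`2a ∉ Λ`), and by Legendre `η₁ω₂ − η₂ω₁ = ±2πi` one of the two multipliers is a non-trivial cube root of unity, because
`3 ∤ m₁` or `3 ∤ m₂` (else `a ∈ Λ`).  [cite: WhittakerWatson1927, §20.421 (quasi-periodicity of σ), §20.411 (Legendre's relation)]
[cite: SilvermanAEC2009, VI.3 and III.8 (the multiplier is the Weil pairing; shape)] -/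
theorem sigmaCubeRootNotPeriodic : SigmaCubeRootNotPeriodic := by
  intro L a m₁ m₂ ha h3a
  set e : ℂ := m₁ * L.η₁ + m₂ * L.η₂ with he
  have h3aΛ : 3 * a ∈ L.lattice := PeriodPair.mem_lattice.mpr ⟨m₁, m₂, h3a.symm⟩
  have h2a : 2 * a ∉ L.lattice := fun h ↦ ha (by
    have := L.lattice.sub_mem h3aΛ h
    rwa [show (3 : ℂ) * a - 2 * a = a by ring] at this)
  have hW0 := sigmaCubeRoot_neg_ne_zero L a e ha h2a
  -- not both `m₁`, `m₂` divisible by `3`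
  have hnd : ¬ ((3 : ℤ) ∣ m₁ ∧ (3 : ℤ) ∣ m₂) := by
    rintro ⟨⟨k₁, hk₁⟩, ⟨k₂, hk₂⟩⟩
    apply ha
    rw [PeriodPair.mem_lattice]
    refine ⟨k₁, k₂, ?_⟩
    have h3 : (3 : ℂ) * a = 3 * (k₁ * L.ω₁ + k₂ * L.ω₂) := by rw [h3a, hk₁, hk₂]; push_cast; ring
    exact (mul_left_cancel₀ (by norm_num : (3 : ℂ) ≠ 0) h3).symm
  -- Legendre: `η₁ω₂ − η₂ω₁ = s·2πi`, `s = ±1`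
  obtain ⟨s, hs, hδ⟩ : ∃ s : ℤ, (s = 1 ∨ s = -1) ∧ L.η₁ * L.ω₂ - L.η₂ * L.ω₁ = (s : ℂ) * (2 * Real.pi * I) := by
    rcases L.im_ω₂_div_ω₁_pos_or with h | h
    · exact ⟨1, Or.inl rfl, by rw [L.legendre_relation_holds h]; simp⟩
    · refine ⟨-1, Or.inr rfl, ?_⟩
      have h' := L.legendre_relation_of_neg h
      linear_combination -h'
  -- `a = (m₁ω₁ + m₂ω₂)/3`
  have ha3 : a = (m₁ * L.ω₁ + m₂ * L.ω₂) / 3 := by rw [← h3a]; ring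
  by_cases hm₁ : (3 : ℤ) ∣ m₁
  · -- use `ω₁`: multiplier `exp(−m₂ s 2πi/3)`, and `3 ∤ m₂`
    have hm₂ : ¬ (3 : ℤ) ∣ m₂ := fun h ↦ hnd ⟨hm₁, h⟩
    refine ⟨L.ω₁, L.ω₁_mem_lattice, -a, fun hper ↦ hm₂ ?_⟩
    rw [sigmaCubeRoot_neg_add_ω₁ L a e ha] at hper
    have hexp : cexp (e * L.ω₁ / 3 - L.η₁ * a) = 1 := by
      have := mul_right_cancel₀ hW0 (hper.trans (one_mul _).symm)
      exact this
    have hE : e * L.ω₁ / 3 - L.η₁ * a = ((-m₂ : ℤ) : ℂ) * ((s : ℂ) * (2 * Real.pi * I)) / 3 := by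
      rw [he, ha3]
      push_cast
      linear_combination (-(m₂ : ℂ) / 3) * hδ
    rw [hE] at hexp
    have := three_dvd_of_cexp_eq_one hs hexp
    exact (dvd_neg).mp this
  · -- use `ω₂`: multiplier `exp(m₁ s 2πi/3)`
    refine ⟨L.ω₂, L.ω₂_mem_lattice, -a, fun hper ↦ hm₁ ?_⟩
    rw [sigmaCubeRoot_neg_add_ω₂ L a e ha] at hper
    have hexp : cexp (e * L.ω₂ / 3 - L.η₂ * a) = 1 := by
      have := mul_right_cancel₀ hW0 (hper.trans (one_mul _).symm)
      exact this
    have hE : e * L.ω₂ / 3 - L.η₂ * a = ((m₁ : ℤ) : ℂ) * ((s : ℂ) * (2 * Real.pi * I)) / 3 := by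
      rw [he, ha3]
      linear_combination ((m₁ : ℂ) / 3) * hδ
    rw [hE] at hexp
    exact three_dvd_of_cexp_eq_one hs hexp

/-! ### S6 — rational `3`-torsion of the short model lifts to a third-period -/

/-- The short model at `c = 0` is the cuspidal cubic `y² = x³`, which has no nonsingular point with `Ψ₃(x) = 3x⁴ = 0`:
so a short `3`-torsion datum forces `c ≠ 0`. [folklore] -/
theorem maninConstant_ne_zero_of_isShortThreeTorsion (W : WeierstrassCurve ℚ) {c : ℤ} {X₀ Y₀ : ℚ}
    (hT : IsShortThreeTorsion W c X₀ Y₀) : c ≠ 0 := by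
  rintro rfl
  obtain ⟨hns, hΨ⟩ := hT
  rw [WeierstrassCurve.Affine.nonsingular_iff', WeierstrassCurve.Affine.equation_iff'] at hns
  rw [Polynomial.IsRoot, WeierstrassCurve.Ψ₃] at hΨ
  simp only [shortModel, Int.cast_zero, WeierstrassCurve.b₂, WeierstrassCurve.b₄, WeierstrassCurve.b₆, WeierstrassCurve.b₈,
    Polynomial.eval_add, Polynomial.eval_mul, Polynomial.eval_pow, Polynomial.eval_C, Polynomial.eval_X,
    Polynomial.eval_ofNat] at hns hΨ
  norm_num at hns hΨ
  obtain ⟨heq, hne⟩ := hns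
  subst hΨ
  norm_num at heq hne
  exact hne heq

/-- **S6 `ShortThreeTorsionLift` PROVED.**  A rational point `(X₀, Y₀)` of order `3` on the short model `E_{W,c}` is
`(c²℘(a), c³℘'(a)/2)` for a third-period `a` (`3a ∈ Λ ∌ a`) of the Néron lattice, with `℘'(a) ≠ 0` and `c ≠ 0`:
`Ψ₃^{E_{W,c}}(c²(x + b₂/12)) = c⁸Ψ₃^W(x)` (`shortModel_Ψ₃_quartic_eq`), a third-period with `℘ = X₀/c²` exists
(`exists_third_period_of_Ψ₃_root`: `℘` is onto, `Ψ₃(℘ a) = 0 ⟺ 3a ∈ Λ`), `Y₀² = X₀³ + a₄X₀ + a₆ = (c³℘'(a)/2)²`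
(`derivWeierstrassP_sq`, `g₂ = c₄/12`, `g₃ = c₆/216`) fixes the sign up to `a ↦ −a`, and `℘'(a) = 0` would put `2a ∈ Λ`,
hence `a ∈ Λ`. [cite: SilvermanAEC2009, VI.3.6 and Exercise 3.7 (Ψ₃ and 3-torsion), VI.5.1] -/
theorem shortThreeTorsionLift : ShortThreeTorsionLift := by
  intro W _ _ N _ D X₀ Y₀ hT
  have hc : D.c ≠ 0 := maninConstant_ne_zero_of_isShortThreeTorsion W hT
  have hcQ : (D.c : ℚ) ≠ 0 := Int.cast_ne_zero.mpr hc
  have hcC : (D.c : ℂ) ≠ 0 := Int.cast_ne_zero.mpr hc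
  refine ⟨hc, ?_⟩
  obtain ⟨hns, hΨ⟩ := hT
  have heq : Y₀ ^ 2 = X₀ ^ 3 + (shortModel W D.c).a₄ * X₀ + (shortModel W D.c).a₆ := by
    have h := (WeierstrassCurve.Affine.equation_iff _ _).mp hns.1
    simpa [shortModel] using h
  -- `X₀ = c²(x + b₂/12)` with `x = X₀/c² − b₂/12`, and `Ψ₃^W(x) = 0`
  set x : ℚ := X₀ / (D.c : ℚ) ^ 2 - W.b₂ / 12 with hx
  have hX₀ : (D.c : ℚ) ^ 2 * (x + W.b₂ / 12) = X₀ := by rw [hx]; field_simp; ring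
  have hΨW : W.Ψ₃.eval (X₀ / (D.c : ℚ) ^ 2 - W.b₂ / 12) = 0 := by
    rw [Polynomial.IsRoot, WeierstrassCurve.Ψ₃] at hΨ
    simp only [WeierstrassCurve.b₂, WeierstrassCurve.b₄, WeierstrassCurve.b₆, WeierstrassCurve.b₈,
      Polynomial.eval_add, Polynomial.eval_mul, Polynomial.eval_pow, Polynomial.eval_C, Polynomial.eval_X,
      Polynomial.eval_ofNat, shortModel] at hΨ
    -- `Ψ₃^{E_{W,c}}(X₀) = c⁸ · Ψ₃^W(X₀/c² − b₂/12)`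
    have hscale : (D.c : ℚ) ^ 8 * (3 * x ^ 4 + W.b₂ * x ^ 3 + 3 * W.b₄ * x ^ 2 + 3 * W.b₆ * x + W.b₈) =
        3 * X₀ ^ 4 + 6 * (-((D.c : ℚ) ^ 4 * W.c₄ / 48)) * X₀ ^ 2 + 12 * (-((D.c : ℚ) ^ 6 * W.c₆ / 864)) * X₀ -
          (-((D.c : ℚ) ^ 4 * W.c₄ / 48)) ^ 2 := by
      rw [hx]
      simp only [WeierstrassCurve.c₄, WeierstrassCurve.c₆, WeierstrassCurve.b₂, WeierstrassCurve.b₄, WeierstrassCurve.b₆,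
        WeierstrassCurve.b₈]
      field_simp
      ring
    have hquart : 3 * x ^ 4 + W.b₂ * x ^ 3 + 3 * W.b₄ * x ^ 2 + 3 * W.b₆ * x + W.b₈ = 0 := by
      have h0 : (D.c : ℚ) ^ 8 * (3 * x ^ 4 + W.b₂ * x ^ 3 + 3 * W.b₄ * x ^ 2 + 3 * W.b₆ * x + W.b₈) = 0 := by
        rw [hscale]
        linear_combination hΨ
      rcases mul_eq_zero.mp h0 with h | h
      · exact absurd h (pow_ne_zero 8 hcQ)
      · exact h
    rw [← hx, WeierstrassCurve.Ψ₃]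
    simp only [Polynomial.eval_add, Polynomial.eval_mul, Polynomial.eval_pow, Polynomial.eval_C, Polynomial.eval_X,
      Polynomial.eval_ofNat]
    linear_combination hquart
  obtain ⟨z₀, hz₀, h℘, h3⟩ := exists_third_period_of_Ψ₃_root W D.isNeronLattice _ hΨW
  -- `c²℘(z₀) = X₀`
  have hXC : (D.c : ℂ) ^ 2 * ℘[D.L] z₀ = (X₀ : ℂ) := by
    rw [h℘]; push_cast; field_simp
  -- `(c³℘'(z₀)/2)² = Y₀²`
  have hg₂ : D.L.g₂ = (W.c₄ : ℂ) / 12 := by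
    have h := D.isNeronLattice.1; rw [WeierstrassCurve.baseChange, map_c₄] at h; simpa using h
  have hg₃ : D.L.g₃ = (W.c₆ : ℂ) / 216 := by
    have h := D.isNeronLattice.2; rw [WeierstrassCurve.baseChange, map_c₆] at h; simpa using h
  have hsq : ((D.c : ℂ) ^ 3 * ℘'[D.L] z₀ / 2) ^ 2 = (Y₀ : ℂ) ^ 2 := by
    have heqC : ((Y₀ ^ 2 : ℚ) : ℂ) = ((X₀ ^ 3 + (shortModel W D.c).a₄ * X₀ + (shortModel W D.c).a₆ : ℚ) : ℂ) := by rw [heq]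
    simp only [shortModel] at heqC
    push_cast at heqC
    rw [heqC, ← hXC, div_pow, mul_pow, ← pow_mul, D.L.derivWeierstrassP_sq z₀ hz₀, hg₂, hg₃]
    ring
  -- `℘'(z₀) ≠ 0`
  have h℘' : ℘'[D.L] z₀ ≠ 0 := by
    intro h0
    have h2 := D.L.two_mul_mem_lattice_of_derivWeierstrassP_eq_zero hz₀ h0
    apply hz₀
    have := D.L.lattice.sub_mem h3 h2
    rwa [show (3 : ℂ) * z₀ - 2 * z₀ = z₀ by ring] at this
  -- choose the sign
  rcases sq_eq_sq_iff_eq_or_eq_neg.mp hsq with hpos | hneg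
  · exact ⟨z₀, hz₀, h3, h℘', hXC, hpos⟩
  · refine ⟨-z₀, fun h ↦ hz₀ (by simpa using D.L.lattice.neg_mem h), ?_, ?_, ?_, ?_⟩
    · have := D.L.lattice.neg_mem h3; simpa [mul_neg] using this
    · rw [PeriodPair.derivWeierstrassP_neg]; exact neg_ne_zero.mpr h℘'
    · rw [PeriodPair.weierstrassP_neg]; exact hXC
    · rw [PeriodPair.derivWeierstrassP_neg, mul_neg, neg_div, hneg, neg_neg]

end Summit.BirchSwinnertonDyer.BirchSwinnertonDyer.Theorems.ManinLocalTwoThree.KummerCubeSigmaLeaves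

end
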